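/-
Copyright (c) 2026. All rights reserved.
Released under Apache 2.0 license as described in the file LICENSE.
Authors: abc-iut cell, seat abc-iut-L4-t10 (gen 4; block W2-B4 model column, node `AbsTopIII:Cor4.5(v)`:
the fourth sentence of (v) at the archimedean models, zero binders).
-/
import Literature.AnabelianGeometry.AbsoluteAnabelian.AbsTopIII.FrobeniusPictureMLFShiftTelecoreCompatible
import Literature.AnabelianGeometry.AbsoluteAnabelian.AbsTopIII.AutHolLogFrobeniusCompatibility
import Literature.AnabelianGeometry.AbsoluteAnabelian.AbsTopIII.AutHolLogFrobeniusModelProofs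
import Literature.AnabelianGeometry.AbsoluteAnabelian.AbsTopIII.AutHolLogFrobeniusGaloisModel
import Literature.AnabelianGeometry.AbsoluteAnabelian.ArchimedeanLogFrobeniusModelTM
import Literature.AnabelianGeometry.AbsoluteAnabelian.ArchimedeanHolFieldFunctorGeometricRC
import HarnessLib

/-!
# [AbsTopIII] Cor 4.5 (v), fourth sentence — the extension of the nexus self-equivalences to the
# telecore `𝔗_LH`, compatible with its family of homotopies and with `ℋ_LH` — DISCHARGED at the
# archimedean models with NO residual hypothesis

S. Mochizuki, *Topics in Absolute Anabelian Geometry III*, Cor 4.5 (v) p. 109 l. 17–21 (kurims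
manuscript, lit key `paper:url-5493eb38cbb7`, read on the page; bib key `MochizukiAbsTopIII2015`):
"these self-equivalences also extend naturally [cf. the technique of extension applied in Definition
3.5, (vi)] to the diagram of categories [cf. Definition 3.5, (iv), (a)] that constitutes the telecore of
(ii), in a fashion that is compatible with both the family of homotopies that constitutes this telecore
structure [cf. Definition 3.5, (iv), (b)] and the contact structure `ℋ_LH` of (ii)."  Printed proof
(p. 110): "Assertion (v) follows by applying the argument applied in the proof of Corollary 3.6, (v)."

PROOF-ONLY companion (no notion is declared) of seat abc-iut-L4-t10's statement file
`AbsTopIII/AutHolLogFrobeniusCompatibility.lean`, where the sentence is the SECOND conjunct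
`Δ.ShiftTelecoreCompatStmt τ` of `AbsTopIII.Cor_4_5_v_compat Δ τ` (abc-iut-L4-t5's literal Def 3.5 (v)
statement, imported, never restated).

State of the tree before this file.  abc-iut-w6-d025's
`FrobeniusPictureMLFShiftTelecoreCompatible.lean` PROVES the sentence over ABSTRACT data from exactly
the two printed-case shape hypotheses of item (ii) — `id_⋎` fully faithful and the first-row telecore
datum coherent with `η` (`LogFrobeniusData.shiftTelecoreCompatStmt_of_coherent`) — and discharges both
at the printed MLF shape (`MonoAnabelianLogFrobeniusData.shiftTelecoreCompatStmt`) and at the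
`TF`-model (`AbsTopIII.TFModel.shiftTelecoreCompatStmt_model`).  The ARCHIMEDEAN models of Cor 4.5
(`archLogFrobeniusData 𝔄` / `archLogFrobeniusDataTM 𝔄` with the printed telecore data
`⟨φ_LH, unitor, η_LH⟩`) were not instantiated there.

This file (every theorem a one-line application BY NAME):

* `AbsTopIII.cor_4_5_v_shiftTelecoreCompat_arch`, `…_arch_TM` — **the fourth sentence of Cor 4.5 (v)
  at BOTH archimedean models (`𝒳 = 𝒞^hol_TF`, `𝒳 = 𝒞^hol_TM`) for EVERY interface datum
  `𝔄 : AutHolFieldFunctor`, ZERO binders**: `id_⋎ = 𝟭` and the telecore datum is coherent by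
  construction (`arch_telecore_coherent`, abc-iut-L4-t10 gen 2; `archTM_telecore_coherent`,
  abc-iut-w5-d226) — the same two inputs that make item (ii) unconditional there
  (`AbsTopIII.cor_4_5_ii_arch`, abc-iut-w6-d023).
* zero-binder corollaries at the tree's model families of the interface: every constant-field datum
  (`…_ofConstField`), every Galois category `B(Π)` with NO slimness input (`…_ofGaloisCategory`), every
  GEOMETRIC carrier property `Q` on connected Riemann surfaces with holomorphic
  (`HolRS.cor_4_5_v_shiftTelecoreCompat_geometric`) or RC-holomorphic (`…_geometricRC`) finite étale
  morphisms — including print's elliptically admissible hyperbolic `EA`, with NO id-rigidity /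
  Lemma-4.3 input (those serve the FIRST two sentences of (v) only).
* `AbsTopIII.cor_4_5_v_compat_arch_of_shiftCompat` — (v) sentences 3 ∧ 4 at the model GIVEN sentence 3
  (`ShiftCompatStmt`: the compatibility of the `Φ_m` with one family realising the cores and `𝔖_log`,
  NOT proved here — it waits on the cell's «Cor36-SHIFT»/«Cor36-CROSS» rows).
* `AbsTopIII.cor_4_5_full_arch_of` — bookkeeping: at the model, `Cor_4_5_full` (all printed clauses)
  follows from `X₀ : EA`, `IsIdRigid EA` (items (i)–(v), `cor_4_5_arch`), the (iii) compatibility clause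
  and sentence 3 of (v); sentence 4 is no longer an input.  This names exactly what remains OPEN at the
  archimedean model: `Cor_4_5_iii_compat` and `ShiftCompatStmt`.

HONEST SCOPE: model-level ≠ node-level ≠ reconstruction; the models' `𝒩` is `𝒞^hol_TH` restricted to
arithmetic data inside CAFs (scope note of `ArchimedeanLogFrobeniusModel.lean`); the geometric `EA` of
Cor 2.7 enters only through the interface `AutHolFieldFunctor`.  Refereed pre-IUT anabelian geometry;
nothing here bears on [IUTchIII] Cor. 3.12 or takes a side; typed ≠ proved.
-/

namespace Literature.AnabelianGeometry.AbsoluteAnabelian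

open _root_.CategoryTheory

universe u

namespace AbsTopIII

variable (𝔄 : AutHolFieldFunctor.{u})

/-! ### The fourth sentence of (v) at the two archimedean models, every `𝔄`, zero binders -/

/-- **[AbsTopIII] Cor 4.5 (v), fourth sentence, at the archimedean MODEL `𝒳 = 𝒞^hol_TF` for EVERY
interface datum `𝔄 : AutHolFieldFunctor`, with NO further hypothesis**: over the telecore `𝔗_LH` of the
printed shape with its contact structure `ℋ_LH`, the nexus self-equivalences `Φ_m` of `𝒟` extend to
self-equivalences `Ψ_m` of `𝒟_LH` — the same functors on `𝒟_{≤4}`, the identity at `LinHol` —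
compatible in the sense of Def. 3.5 (v) with the telecore family and with `ℋ_LH`
(`ShiftTelecoreCompatStmt`).  abc-iut-w6-d025's `shiftTelecoreCompatStmt_of_coherent` with both shape
hypotheses discharged by construction: `id_⋎ = 𝟭` is fully faithful and the printed telecore datum
`⟨φ_LH, unitor, η_LH⟩` is coherent (`arch_telecore_coherent`).
[cite: MochizukiAbsTopIII2015, Corollary 4.5 (v) p.109] -/
theorem cor_4_5_v_shiftTelecoreCompat_arch :
    (archLogFrobeniusData 𝔄).ShiftTelecoreCompatStmt (archTelecoreData 𝔄) :=
  (archLogFrobeniusData 𝔄).shiftTelecoreCompatStmt_of_coherent (archTelecoreData 𝔄)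
    (Functor.FullyFaithful.id (HolTFPair 𝔄)) (arch_telecore_coherent 𝔄)

/-- **[AbsTopIII] Cor 4.5 (v), fourth sentence, at the archimedean MODEL `𝒳 = 𝒞^hol_TM`** ("where
`T ∈ {TM, TF}`"), for EVERY interface datum `𝔄`, with NO further hypothesis (coherence of the `TM`
telecore datum: abc-iut-w5-d226's `archTM_telecore_coherent`).
[cite: MochizukiAbsTopIII2015, Corollary 4.5 (v) p.109] -/
theorem cor_4_5_v_shiftTelecoreCompat_arch_TM :
    (archLogFrobeniusDataTM 𝔄).ShiftTelecoreCompatStmt (archTelecoreDataTM 𝔄) :=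
  (archLogFrobeniusDataTM 𝔄).shiftTelecoreCompatStmt_of_coherent (archTelecoreDataTM 𝔄)
    (Functor.FullyFaithful.id (HolMonoidPair 𝔄 .TM)) (archTM_telecore_coherent 𝔄)

/-- Cor 4.5 (v), fourth sentence, at the archimedean model over EVERY constant-field datum `EA := E`
(any category `E`, `𝒜_𝕏 = ℂ`, induced isomorphisms the identity), zero binders.
[cite: MochizukiAbsTopIII2015, Corollary 4.5 (v) p.109] -/
theorem cor_4_5_v_shiftTelecoreCompat_ofConstField (E : Type 1) [Category.{1} E] :
    (archLogFrobeniusData (AutHolFieldFunctor.ofConstField E)).ShiftTelecoreCompatStmt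
      (archTelecoreData (AutHolFieldFunctor.ofConstField E)) :=
  cor_4_5_v_shiftTelecoreCompat_arch _

/-- **Cor 4.5 (v), fourth sentence, at the Galois-category instance `EA = B(Π)` for EVERY topological
group `Π`, with NO slimness hypothesis** (contrast `cor_4_5_v_arch_ofGaloisCategory_iff`: the first two
sentences of (v) — nexus rigidity — hold there iff `Z(Π) = 1`, abc-iut-w6-d025 / -L4-t10).
[cite: MochizukiAbsTopIII2015, Corollary 4.5 (v) p.109] -/
theorem cor_4_5_v_shiftTelecoreCompat_ofGaloisCategory (G : Type) [Group G] [TopologicalSpace G] :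
    (archLogFrobeniusData (AutHolFieldFunctor.ofGaloisCategory G)).ShiftTelecoreCompatStmt
      (archTelecoreData (AutHolFieldFunctor.ofGaloisCategory G)) :=
  cor_4_5_v_shiftTelecoreCompat_arch _

/-! ### Assembly with the third sentence and with the five items (what remains at the model) -/

/-- **Cor 4.5 (v), third and fourth sentences at the archimedean model, GIVEN the third**
(`AbsTopIII.Cor_4_5_v_compat = ShiftCompatStmt ∧ ShiftTelecoreCompatStmt`): the compatibility of the
`Φ_m` with one family of homotopies realising the cores and `𝔖_log` (`ShiftCompatStmt`) is NOT proved
here; the fourth sentence is no longer an input. [cite: MochizukiAbsTopIII2015, Corollary 4.5 (v) p.109] -/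
theorem cor_4_5_v_compat_arch_of_shiftCompat (h₃ : (archLogFrobeniusData 𝔄).ShiftCompatStmt) :
    Cor_4_5_v_compat (archLogFrobeniusData 𝔄) (archTelecoreData 𝔄) :=
  ⟨h₃, cor_4_5_v_shiftTelecoreCompat_arch 𝔄⟩

/-- The same at the `TM` model. [cite: MochizukiAbsTopIII2015, Corollary 4.5 (v) p.109] -/
theorem cor_4_5_v_compat_arch_TM_of_shiftCompat (h₃ : (archLogFrobeniusDataTM 𝔄).ShiftCompatStmt) :
    Cor_4_5_v_compat (archLogFrobeniusDataTM 𝔄) (archTelecoreDataTM 𝔄) :=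
  ⟨h₃, cor_4_5_v_shiftTelecoreCompat_arch_TM 𝔄⟩

/-- **Corollary 4.5 with ALL its printed clauses at the archimedean model `𝒳 = 𝒞^hol_TF`, from what
remains open there**: the five items need an object `𝕏₀` of `EA` and the id-rigidity of `EA`
(`cor_4_5_arch`, abc-iut-L4-t10 gen 2); the compatibility clause of (iii) (`Cor_4_5_iii_compat`: one
family containing the `𝔖_log` family and the core / telecore families) and the third sentence of (v)
(`ShiftCompatStmt`) are taken as hypotheses BY NAME — they wait on the cell's construction of the master
family (rows «Cor36-CROSS» / «Cor36-SHIFT» / «LogObsCompatTelecore»); the fourth sentence of (v) is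
supplied by `cor_4_5_v_shiftTelecoreCompat_arch`.  Bookkeeping only.
[cite: MochizukiAbsTopIII2015, Corollary 4.5 pp.107–109] -/
theorem cor_4_5_full_arch_of (X₀ : 𝔄.EA) (hE : IsIdRigid 𝔄.EA)
    (hiii : Cor_4_5_iii_compat (archLogFrobeniusData 𝔄) (archTelecoreData 𝔄))
    (h₃ : (archLogFrobeniusData 𝔄).ShiftCompatStmt) :
    Cor_4_5_full (archLogFrobeniusData 𝔄) (archTelecoreData 𝔄) :=
  ⟨cor_4_5_arch 𝔄 X₀ hE, hiii, h₃, cor_4_5_v_shiftTelecoreCompat_arch 𝔄⟩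

/-- At the archimedean model the full corollary reduces to EXACTLY four inputs: `𝕏₀ : EA`,
`IsIdRigid EA`, the (iii) compatibility clause and sentence 3 of (v) — conversely the full form returns
the last two (the first two are consumed, not recovered). [cite: MochizukiAbsTopIII2015, Corollary 4.5 pp.107–109] -/
theorem cor_4_5_full_arch_iff (X₀ : 𝔄.EA) (hE : IsIdRigid 𝔄.EA) :
    Cor_4_5_full (archLogFrobeniusData 𝔄) (archTelecoreData 𝔄) ↔
      Cor_4_5_iii_compat (archLogFrobeniusData 𝔄) (archTelecoreData 𝔄) ∧
        (archLogFrobeniusData 𝔄).ShiftCompatStmt :=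
  ⟨fun h => ⟨h.2.1, h.2.2.1⟩, fun h => cor_4_5_full_arch_of 𝔄 X₀ hE h.1 h.2⟩

end AbsTopIII

namespace HolRS

/-- **[AbsTopIII] Cor 4.5 (v), fourth sentence, at the GEOMETRIC model for EVERY object property `Q`
of connected Riemann surfaces** — `EA = EA^hol_RS(Q)` (abc-iut-L4-t14's `geometricAutHolFieldFunctor Q`,
holomorphic finite étale morphisms), in particular for print's elliptically admissible hyperbolic
orbicurves — with NO id-rigidity / Lemma-4.3 input (contrast `cor_4_5_geometric (X₀) (hE : IsIdRigid EA)`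
and the zero-binder carriers file, needed for the first two sentences of (v)).
[cite: MochizukiAbsTopIII2015, Corollary 4.5 (v) p.109] -/
theorem cor_4_5_v_shiftTelecoreCompat_geometric (Q : ObjectProperty HolRS) :
    (archLogFrobeniusData (geometricAutHolFieldFunctor Q)).ShiftTelecoreCompatStmt
      (archTelecoreData (geometricAutHolFieldFunctor Q)) :=
  AbsTopIII.cor_4_5_v_shiftTelecoreCompat_arch _

/-- **Cor 4.5 (v), fourth sentence, at the RC-holomorphic geometric model** (`EA =` the full
subcategory of `HolRS.RC` cut out by `Q`; RC-holomorphic finite étale morphisms, `𝒜_φ = id / conj`),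
every `Q`, zero binders. [cite: MochizukiAbsTopIII2015, Corollary 4.5 (v) p.109] -/
theorem cor_4_5_v_shiftTelecoreCompat_geometricRC (Q : ObjectProperty RC) :
    (archLogFrobeniusData (geometricAutHolFieldFunctorRC Q)).ShiftTelecoreCompatStmt
      (archTelecoreData (geometricAutHolFieldFunctorRC Q)) :=
  AbsTopIII.cor_4_5_v_shiftTelecoreCompat_arch _

end HolRS

end Literature.AnabelianGeometry.AbsoluteAnabelian
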